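import Literature.NumberTheory.Sieve.SmoothLocalBehaviourHT
import Literature.NumberTheory.Sieve.SmoothCountDickmanLower
import HarnessLib

/-!
# Hildebrand–Tenenbaum's local behaviour `Ψ(cx, y) = Ψ(x, y) c^α (1 + O(1/u + log y/y))` from Theorem 1

Topic `Literature/NumberTheory/Sieve`; PROOF companion of `SmoothLocalBehaviourHT.lean`, whose named fact
`Literature.NumberTheory.Sieve.HTLocalBehaviour` is A. Hildebrand, G. Tenenbaum, *On integers free of
large prime factors*, Trans. AMS 296 (1986) 265–290 [HildebrandTenenbaum1986], Theorem 3 (2.9):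
"uniformly for `x ≥ y ≥ 2` and `1 ≤ c ≤ y`, `Ψ(cx, y) = Ψ(x, y) c^{α(x,y)} (1 + O(1/u + (log y)/y))`".

The paper deduces Theorem 3 from its Theorem 1 (the saddle-point asymptotic
`Ψ(x, y) = x^α ζ(α, y)/(α √(2π φ₂(α, y))) (1 + O(1/u + log y/y))` uniformly for `x ≥ y ≥ 2`) in §6
(pp. 282–284); Theorem 1 itself rests on the prime number theorem with Vinogradov's zero-free region
(Lemma 6), the decay Lemma 8 and, for small `u`, on de Bruijn's `Ψ(x, y) ∼ x ρ(u)` — none of which is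
in Mathlib or the tree. This file PROVES the deduction of §6:

* `HTLocalBehaviour_of_saddleAsymptotic` — Theorem 1 (stated verbatim as the hypothesis, for real `x`
  and natural `y`, `2 ≤ y ≤ x`, with the tree's `saddlePoint`, `smoothZeta`, `saddlePhi₂`) implies
  `HTLocalBehaviour`.

Everything else is unconditional and proved here or in the tool files `SmoothSaddlePointUniform`
(uniform orders of `α`, `φ₂(α, y)`), `SmoothCountDickmanLower` (`Ψ(x, y) ≫_{u₀} x` for `u ≤ u₀`).

## The argument (op. cit. §6, made derivative-free)

As in the paper, the cases `y ≤ y₀` and `u ≤ u₀` only need the upper bound `Ψ(cx, y) ≪ c^α Ψ(x, y)`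
(the error factor is then `≫ 1`): for `y ≤ y₀` this is elementary (`card_smoothNumbersUpTo_two_mul_le`:
`Ψ(2z, y) ≤ (1 + y) Ψ(z, y)`, dividing by the least prime factor; the paper quotes Ennola), and for
`u ≤ u₀` it follows from `Ψ(cx, y) ≤ cx`, `Ψ(x, y) ≥ δ(u₀) x` (`SmoothCountDickmanLower`, replacing de
Bruijn's (1.5)) and `c^{1-α} ≤ y^{1-α} ≤ (80 u₀)²` (`exists_one_sub_saddlePoint_mul_log_le`, the paper's
"`α = 1 + O(1/log y)`"). In the main case `y > y₀`, `u > u₀`, Theorem 1 at `x` and at `cx` (errors `E ≤ 1/2`)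
reduces (2.9) to `log M(cx) - log M(x) = α log c + O(1/u)` for the main term `M`, i.e. (with
`α' = α(cx, y) ≤ α`, `L' = log(cx)`, `Δ = α - α' ≤ log c/φ₂(α, y)` by the tangent inequality) to
`G + log(α/α') + ½ log(φ₂(α', y)/φ₂(α, y)) ≪ 1/u`, where `0 ≤ G = (αL' + log ζ(α)) - (α'L' + log ζ(α'))
≤ φ₂(α')Δ²/2` (`log_smoothZeta_sub_le`) — the paper's `f(u+t) - f(u) - t f'(u) ≪ sup |f''|` without
differentiating in `u`. The three terms are `≪ 1/u` by `φ₂(α, y) ≫ log x log y`, `φ₂(α, y) ≫ (log x)² log y/y`,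
`α' ≫ min(1/log y, y/(log y log cx))` and `φ₂(α') ≤ e^{Δ(log y + 2/α')} φ₂(α)` (`SmoothSaddlePointUniform`,
Lemmas 2 and 4 of the paper up to constants).

## References

* [HildebrandTenenbaum1986] A. Hildebrand, G. Tenenbaum, Trans. AMS 296 (1986) 265–290: Thm 1 (2.3),
  Thm 3 (2.9), §6 (proof of Thm 3), held: `paper:doi-10-1090-s0002-9947-1986-0837811-1`, pp. 267,
  269, 282–284.
-/

noncomputable section

open Real Finset

namespace Literature.NumberTheory.Sieve

/-! ### Elementary bounds for `Ψ` -/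

/-- `Ψ(z, y) ≤ z` for `z ≥ 0` (the elements of `Nat.smoothNumbersUpTo N k` lie in `[1, N]`). [folklore] -/
theorem card_smoothNumbersUpTo_le_self {z : ℝ} (hz : 0 ≤ z) (y : ℕ) :
    ((Nat.smoothNumbersUpTo ⌊z⌋₊ (y + 1)).card : ℝ) ≤ z := by
  have hsub : Nat.smoothNumbersUpTo ⌊z⌋₊ (y + 1) ⊆ Finset.Icc 1 ⌊z⌋₊ := by
    intro n hn
    rw [Nat.mem_smoothNumbersUpTo] at hn
    rw [Finset.mem_Icc]
    exact ⟨Nat.one_le_iff_ne_zero.2 hn.2.1, hn.1⟩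
  have h1 := Finset.card_le_card hsub
  rw [Nat.card_Icc, Nat.add_sub_cancel] at h1
  calc ((Nat.smoothNumbersUpTo ⌊z⌋₊ (y + 1)).card : ℝ) ≤ ⌊z⌋₊ := by exact_mod_cast h1
    _ ≤ z := Nat.floor_le hz

/-- `Ψ(z, y) ≥ 1` for `z ≥ 1` (`n = 1` is counted). [folklore] -/
theorem one_le_card_smoothNumbersUpTo {z : ℝ} (hz : 1 ≤ z) (y : ℕ) :
    (1 : ℝ) ≤ ((Nat.smoothNumbersUpTo ⌊z⌋₊ (y + 1)).card : ℝ) := by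
  have h1 : 1 ∈ Nat.smoothNumbersUpTo ⌊z⌋₊ (y + 1) := by
    rw [Nat.mem_smoothNumbersUpTo, Nat.mem_smoothNumbers]
    refine ⟨Nat.le_floor (by simpa using hz), one_ne_zero, ?_⟩
    simp
  have : 1 ≤ (Nat.smoothNumbersUpTo ⌊z⌋₊ (y + 1)).card := Finset.card_pos.2 ⟨1, h1⟩
  exact_mod_cast this

/-- `Ψ` is non-decreasing in `z`. [folklore] -/
theorem card_smoothNumbersUpTo_mono {z z' : ℝ} (hzz' : z ≤ z') (y : ℕ) :
    ((Nat.smoothNumbersUpTo ⌊z⌋₊ (y + 1)).card : ℝ) ≤ ((Nat.smoothNumbersUpTo ⌊z'⌋₊ (y + 1)).card : ℝ) := by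
  have hsub : Nat.smoothNumbersUpTo ⌊z⌋₊ (y + 1) ⊆ Nat.smoothNumbersUpTo ⌊z'⌋₊ (y + 1) := by
    intro n hn
    rw [Nat.mem_smoothNumbersUpTo] at hn ⊢
    exact ⟨hn.1.trans (Nat.floor_mono hzz'), hn.2⟩
  exact_mod_cast Finset.card_le_card hsub

/-- **Doubling**: `Ψ(2z, y) ≤ (1 + y) Ψ(z, y)` for `z ≥ 1`: a `y`-smooth `n ∈ (z, 2z]` is `≥ 2`, and
`n ↦ (P⁻(n), n/P⁻(n))` maps it injectively to a pair (prime `≤ y`, `y`-smooth integer `≤ z`). (The paper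
treats bounded `y` by Ennola's theorem (1.9); this crude bound is all that is needed.) [folklore] -/
theorem card_smoothNumbersUpTo_two_mul_le {z : ℝ} (hz : 1 ≤ z) (y : ℕ) :
    ((Nat.smoothNumbersUpTo ⌊2 * z⌋₊ (y + 1)).card : ℝ) ≤
      (1 + y) * ((Nat.smoothNumbersUpTo ⌊z⌋₊ (y + 1)).card : ℝ) := by
  classical
  set A := Nat.smoothNumbersUpTo ⌊2 * z⌋₊ (y + 1) with hA
  set B := Nat.smoothNumbersUpTo ⌊z⌋₊ (y + 1) with hB
  have hz0 : 0 ≤ z := by linarith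
  have hBA : B ⊆ A := by
    intro n hn
    rw [hB, Nat.mem_smoothNumbersUpTo] at hn
    rw [hA, Nat.mem_smoothNumbersUpTo]
    exact ⟨hn.1.trans (Nat.floor_mono (by linarith)), hn.2⟩
  -- the injection on `A \\ B`
  have hinj : ((A \ B).card : ℝ) ≤ y * (B.card : ℝ) := by
    have hmap : ∀ n ∈ A \ B, (n.minFac, n / n.minFac) ∈ (Nat.primesLE y) ×ˢ B := by
      intro n hn
      rw [Finset.mem_sdiff, hA, hB, Nat.mem_smoothNumbersUpTo, Nat.mem_smoothNumbersUpTo] at hn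
      obtain ⟨⟨hn2z, hns⟩, hnB⟩ := hn
      have hn0 : n ≠ 0 := hns.1
      have hnz : ⌊z⌋₊ < n := by
        by_contra hcon; push Not at hcon
        exact hnB ⟨hcon, hns⟩
      have hn1 : n ≠ 1 := by
        intro h1; rw [h1] at hnz
        have : 1 ≤ ⌊z⌋₊ := Nat.le_floor (by simpa using hz)
        omega
      have hmin : n.minFac.Prime := Nat.minFac_prime hn1
      have hmin_dvd : n.minFac ∣ n := Nat.minFac_dvd n
      rw [Finset.mem_product, Nat.mem_primesLE, Nat.mem_smoothNumbersUpTo]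
      refine ⟨⟨?_, hmin⟩, ?_, Nat.mem_smoothNumbers_of_dvd hns (Nat.div_dvd_of_dvd hmin_dvd)⟩
      · -- `minFac n ≤ y`
        have := (Nat.mem_smoothNumbers.1 hns).2 n.minFac ((Nat.mem_primeFactorsList hn0).2 ⟨hmin, hmin_dvd⟩)
        omega
      · -- `n / minFac n ≤ n/2 ≤ z`
        have h2 : n / n.minFac ≤ n / 2 := Nat.div_le_div_left hmin.two_le two_pos
        refine le_trans h2 (Nat.le_floor ?_)
        have hn2z' : (n : ℝ) ≤ 2 * z := le_trans (by exact_mod_cast hn2z) (Nat.floor_le (by linarith))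
        calc ((n / 2 : ℕ) : ℝ) ≤ (n : ℝ) / 2 := Nat.cast_div_le
          _ ≤ z := by linarith
    have hinj' : Set.InjOn (fun n : ℕ => (n.minFac, n / n.minFac)) (A \ B : Finset ℕ) := by
      intro n _ m _ h
      simp only [Prod.mk.injEq] at h
      obtain ⟨h1, h2⟩ := h
      calc n = n.minFac * (n / n.minFac) := (Nat.mul_div_cancel' (Nat.minFac_dvd n)).symm
        _ = m.minFac * (m / m.minFac) := by rw [h2, h1]
        _ = m := Nat.mul_div_cancel' (Nat.minFac_dvd m)
    have h := Finset.card_le_card_of_injOn _ hmap hinj'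
    rw [Finset.card_product, Nat.primesLE_card_eq_primeCounting] at h
    have hπ : Nat.primeCounting y ≤ y := by
      rw [← Nat.primesLE_card_eq_primeCounting]
      calc #(Nat.primesLE y) ≤ #(Finset.Icc 1 y) := by
            refine Finset.card_le_card fun p hp => ?_
            rw [Nat.mem_primesLE] at hp
            rw [Finset.mem_Icc]
            exact ⟨hp.2.one_le, hp.1⟩
        _ = y := by simp
    calc ((A \ B).card : ℝ) ≤ ((Nat.primeCounting y * B.card : ℕ) : ℝ) := by exact_mod_cast h
      _ = (Nat.primeCounting y : ℝ) * B.card := by push_cast; ring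
      _ ≤ y * (B.card : ℝ) := by
          refine mul_le_mul_of_nonneg_right ?_ (Nat.cast_nonneg _)
          exact_mod_cast hπ
  have hcard : (A.card : ℝ) = (A \ B).card + B.card := by
    have := Finset.card_sdiff_add_card_eq_card hBA
    exact_mod_cast this.symm
  rw [hcard]
  linarith

/-- **Bounded `y`**: `Ψ(cx, y) ≤ (1 + y)^k Ψ(x, y)` for `x ≥ 1` and `c ≤ 2^k` (iterate the doubling
bound). [folklore] -/
theorem card_smoothNumbersUpTo_mul_le_pow (k : ℕ) {x c : ℝ} (hx : 1 ≤ x) (hck : c ≤ 2 ^ k) (y : ℕ) :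
    ((Nat.smoothNumbersUpTo ⌊c * x⌋₊ (y + 1)).card : ℝ) ≤
      (1 + y) ^ k * ((Nat.smoothNumbersUpTo ⌊x⌋₊ (y + 1)).card : ℝ) := by
  -- `Ψ(2^k x) ≤ (1+y)^k Ψ(x)` by induction
  have hiter : ∀ j : ℕ, ((Nat.smoothNumbersUpTo ⌊2 ^ j * x⌋₊ (y + 1)).card : ℝ) ≤
      (1 + y) ^ j * ((Nat.smoothNumbersUpTo ⌊x⌋₊ (y + 1)).card : ℝ) := by
    intro j
    induction j with
    | zero => simp
    | succ j ih =>
        have h1 : (1 : ℝ) ≤ 2 ^ j * x := by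
          have : (1 : ℝ) ≤ 2 ^ j := one_le_pow₀ (by norm_num)
          nlinarith
        have h2 := card_smoothNumbersUpTo_two_mul_le h1 y
        rw [show (2 : ℝ) * (2 ^ j * x) = 2 ^ (j + 1) * x by ring] at h2
        have hy0 : (0 : ℝ) ≤ 1 + y := by positivity
        calc ((Nat.smoothNumbersUpTo ⌊2 ^ (j + 1) * x⌋₊ (y + 1)).card : ℝ)
            ≤ (1 + y) * ((Nat.smoothNumbersUpTo ⌊2 ^ j * x⌋₊ (y + 1)).card : ℝ) := h2
          _ ≤ (1 + y) * ((1 + y) ^ j * ((Nat.smoothNumbersUpTo ⌊x⌋₊ (y + 1)).card : ℝ)) :=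
              mul_le_mul_of_nonneg_left ih hy0
          _ = (1 + y) ^ (j + 1) * ((Nat.smoothNumbersUpTo ⌊x⌋₊ (y + 1)).card : ℝ) := by ring
  have hmono := card_smoothNumbersUpTo_mono (z := c * x) (z' := 2 ^ k * x)
    (mul_le_mul_of_nonneg_right hck (by linarith)) y
  exact hmono.trans (hiter k)

/-! ### Real-variable lemmas -/

/-- From `|Ψ - M| ≤ E M` with `M > 0`, `0 ≤ E ≤ 1/2`: `Ψ > 0` and `|log Ψ - log M| ≤ 2E`. [folklore] -/
theorem abs_log_sub_log_le_of_abs_sub_le {Ψ M E : ℝ} (hM : 0 < M) (hE0 : 0 ≤ E) (hE : E ≤ 1 / 2)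
    (h : |Ψ - M| ≤ E * M) : 0 < Ψ ∧ |Real.log Ψ - Real.log M| ≤ 2 * E := by
  rw [abs_le] at h
  obtain ⟨h1, h2⟩ := h
  have hΨlo : (1 - E) * M ≤ Ψ := by linarith
  have hΨhi : Ψ ≤ (1 + E) * M := by linarith
  have hΨ0 : 0 < Ψ := lt_of_lt_of_le (by nlinarith) hΨlo
  refine ⟨hΨ0, ?_⟩
  rw [abs_le]
  constructor
  · -- `log Ψ - log M ≥ log(1 - E) ≥ -2E`
    have h3 : Real.log ((1 - E) * M) ≤ Real.log Ψ := Real.log_le_log (by nlinarith) hΨlo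
    rw [Real.log_mul (by linarith) hM.ne'] at h3
    -- `log(1-E) ≥ -2E`: `log(1/(1-E)) ≤ 1/(1-E) - 1 = E/(1-E) ≤ 2E`
    have h4 : -(2 * E) ≤ Real.log (1 - E) := by
      have h5 := Real.log_le_sub_one_of_pos (show 0 < 1 / (1 - E) by apply div_pos one_pos; linarith)
      rw [Real.log_div one_ne_zero (by linarith), Real.log_one, zero_sub] at h5
      have h6 : 1 / (1 - E) - 1 ≤ 2 * E := by
        rw [div_sub_one (by linarith), div_le_iff₀ (by linarith)]; nlinarith
      linarith
    linarith
  · have h3 : Real.log Ψ ≤ Real.log ((1 + E) * M) := Real.log_le_log hΨ0 hΨhi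
    rw [Real.log_mul (by linarith) hM.ne'] at h3
    have h4 : Real.log (1 + E) ≤ E := by
      have := Real.log_le_sub_one_of_pos (show 0 < 1 + E by linarith); linarith
    linarith

/-- `|e^R - 1| ≤ 2|R|` for `|R| ≤ 1`. [folklore] -/
theorem abs_exp_sub_one_le {R : ℝ} (hR : |R| ≤ 1) : |Real.exp R - 1| ≤ 2 * |R| := by
  rw [abs_le] at hR
  rcases le_or_gt 0 R with h0 | h0
  · rw [abs_of_nonneg h0, abs_of_nonneg (by linarith [Real.add_one_le_exp R])]
    -- `e^R ≤ 1 + R + R²` for `R ≤ 1`... use `e^R ≤ 1/(1-R)`-free bound: `e^R - 1 ≤ R e^R ≤ e R ≤ 2R`? (`e > 2`)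
    -- instead: `e^R ≤ 1 + 2R` on `[0,1]` by convexity: `e^R ≤ (1-R) e^0 + R e^1 ≤ 1 + R(e-1) ≤ 1 + 2R`
    have h1 : Real.exp R ≤ 1 + (Real.exp 1 - 1) * R := by
      have hconv := convexOn_exp.2 (Set.mem_univ (0 : ℝ)) (Set.mem_univ (1 : ℝ))
        (show (0 : ℝ) ≤ 1 - R by linarith) h0 (by ring)
      simp only [smul_eq_mul, mul_zero, mul_one, zero_add, Real.exp_zero] at hconv
      linarith
    have he := Real.exp_one_lt_d9
    nlinarith
  · rw [abs_of_neg h0, abs_of_nonpos (by linarith [Real.exp_le_one_iff.2 h0.le])]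
    have := Real.add_one_le_exp R
    linarith

/-- From `|log Q - log P - log A| ≤ R₀ ≤ 1` (`P, Q, A > 0`): `|Q - A P| ≤ 2 R₀ · A P`. [folklore] -/
theorem abs_sub_mul_le_of_abs_log_le {P Q A R₀ : ℝ} (hP : 0 < P) (hQ : 0 < Q) (hA : 0 < A)
    (hR₀ : R₀ ≤ 1) (h : |Real.log Q - Real.log P - Real.log A| ≤ R₀) :
    |Q - A * P| ≤ 2 * R₀ * (A * P) := by
  set R : ℝ := Real.log Q - Real.log P - Real.log A with hR
  have hQeq : Q = Real.exp R * (A * P) := by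
    rw [hR, Real.exp_sub, Real.exp_sub, Real.exp_log hQ, Real.exp_log hP, Real.exp_log hA]
    field_simp
  have hkey : Q - A * P = (Real.exp R - 1) * (A * P) := by rw [hQeq]; ring
  rw [hkey, abs_mul, abs_of_pos (by positivity : 0 < A * P)]
  have hexp := abs_exp_sub_one_le (h.trans hR₀)
  calc |Real.exp R - 1| * (A * P) ≤ 2 * |R| * (A * P) := mul_le_mul_of_nonneg_right hexp (by positivity)
    _ ≤ 2 * R₀ * (A * P) := by gcongr

/-- The logarithm of Hildebrand–Tenenbaum's main term: for `x > 1`, `y ≥ 2`, `σ > 0`,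
`log(x^σ ζ(σ, y)/(σ √(2π φ₂(σ, y)))) = σ log x + log ζ(σ, y) - log σ - ½ log(2π φ₂(σ, y))`. [folklore] -/
theorem log_mainTerm_eq {x σ : ℝ} {y : ℕ} (hx : 1 < x) (hy : 2 ≤ y) (hσ : 0 < σ) :
    Real.log (x ^ σ * smoothZeta σ y / (σ * Real.sqrt (2 * Real.pi * saddlePhi₂ σ y))) =
      σ * Real.log x + Real.log (smoothZeta σ y) - Real.log σ -
        1 / 2 * Real.log (2 * Real.pi * saddlePhi₂ σ y) := by
  have hx0 : 0 < x := by linarith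
  have hζ : 0 < smoothZeta σ y := smoothZeta_pos hσ
  have hφ : 0 < saddlePhi₂ σ y := saddlePhi₂_pos hy hσ
  have h2πφ : 0 < 2 * Real.pi * saddlePhi₂ σ y := by positivity
  have hsq : 0 < Real.sqrt (2 * Real.pi * saddlePhi₂ σ y) := Real.sqrt_pos.2 h2πφ
  have hxσ : 0 < x ^ σ := Real.rpow_pos_of_pos hx0 σ
  rw [Real.log_div (by positivity) (by positivity), Real.log_mul hxσ.ne' hζ.ne',
    Real.log_mul hσ.ne' hsq.ne', Real.log_sqrt h2πφ.le, Real.log_rpow hx0]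
  ring

/-! ### The core estimate: `log M(cx) - log M(x) = α log c + O(1/u)` -/

set_option maxHeartbeats 400000 in
-- a long estimate with a large context
/-- **The core of §6.** There are absolute `K` and `y₀` such that for `y ≥ y₀`, `x ≥ y`, `1 ≤ c ≤ y`,
with `α = α(x, y)`, `α' = α(cx, y)`, `L = log x`, `L' = log(cx)`:
`|(α'L' + log ζ(α') - log α' - ½ log(2πφ₂(α'))) - (αL + log ζ(α) - log α - ½ log(2πφ₂(α))) - α log c|
≤ K log y/log x` — Hildebrand–Tenenbaum's `f(u + t) - f(u) = t α_u log y + O(1/u)` ((6.3)), here from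
`0 ≤ G ≤ φ₂(α')Δ²/2`, `0 ≤ log(α/α') ≤ Δ/α'`, `0 ≤ ½ log(φ₂(α')/φ₂(α)) ≤ ½ Δ(log y + 2/α')`,
`Δ = α - α' ≤ log c/φ₂(α)`, and the uniform orders of `φ₂(α)`, `α'` (`SmoothSaddlePointUniform`).
[cite: HildebrandTenenbaum1986, §6 (6.3)–(6.5)] -/
theorem exists_abs_log_mainTerm_sub_le :
    ∃ K : ℝ, ∃ y₀ : ℕ, 0 < K ∧ 2 ≤ y₀ ∧ ∀ (x : ℝ) (y : ℕ) (c : ℝ), y₀ ≤ y → (y : ℝ) ≤ x → 1 ≤ c → c ≤ y →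
      |(saddlePoint (c * x) y * Real.log (c * x) + Real.log (smoothZeta (saddlePoint (c * x) y) y) -
          Real.log (saddlePoint (c * x) y) -
          1 / 2 * Real.log (2 * Real.pi * saddlePhi₂ (saddlePoint (c * x) y) y)) -
        (saddlePoint x y * Real.log x + Real.log (smoothZeta (saddlePoint x y) y) -
          Real.log (saddlePoint x y) - 1 / 2 * Real.log (2 * Real.pi * saddlePhi₂ (saddlePoint x y) y)) -
        saddlePoint x y * Real.log c| ≤ K * (Real.log y / Real.log x) := by
  obtain ⟨c₁, y₁, hc₁, hy₁2, hΦ⟩ := le_saddlePhi₂_saddlePoint_uniform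
  obtain ⟨y₂, hy₂2, hαmin⟩ := exists_min_le_saddlePoint
  set K₄ : ℝ := 12 / c₁ + 144 with hK₄
  set K₅ : ℝ := 1 / c₁ + 2 * K₄ with hK₅
  set K : ℝ := Real.exp K₅ / (2 * c₁) + 1 / (2 * c₁) + 2 * K₄ with hK
  have hK₄0 : 0 < K₄ := by positivity
  have hK0 : 0 < K := by positivity
  refine ⟨K, max y₁ y₂, hK0, le_trans hy₁2 (le_max_left _ _), fun x y c hy hyx hc1 hcy => ?_⟩
  have hy₁ : y₁ ≤ y := le_trans (le_max_left _ _) hy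
  have hy₂ : y₂ ≤ y := le_trans (le_max_right _ _) hy
  have hy2 : 2 ≤ y := hy₁2.trans hy₁
  have hy2r : (2 : ℝ) ≤ y := by exact_mod_cast hy2
  have hy1 : (1 : ℝ) < y := by linarith
  have hy0 : (0 : ℝ) < y := by linarith
  have hx1 : 1 < x := by linarith
  have hx0 : 0 < x := by linarith
  have hc0 : 0 < c := by linarith
  have hcx : x ≤ c * x := le_mul_of_one_le_left hx0.le hc1
  have hcx1 : 1 < c * x := lt_of_lt_of_le hx1 hcx
  have hycx : (y : ℝ) ≤ c * x := hyx.trans hcx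
  -- logarithms
  set ℓ : ℝ := Real.log y with hℓ
  set L : ℝ := Real.log x with hL
  set L' : ℝ := Real.log (c * x) with hL'
  have hℓ0 : 0 < ℓ := Real.log_pos hy1
  have hL0 : 0 < L := Real.log_pos hx1
  have hlogc0 : 0 ≤ Real.log c := Real.log_nonneg hc1
  have hlogcℓ : Real.log c ≤ ℓ := Real.log_le_log hc0 hcy
  have hℓL : ℓ ≤ L := Real.log_le_log hy0 hyx
  have hL'eq : L' = L + Real.log c := by rw [hL', hL, Real.log_mul hc0.ne' hx0.ne']; ring
  have hL'L : L ≤ L' := by rw [hL'eq]; linarith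
  have hL'2L : L' ≤ 2 * L := by rw [hL'eq]; linarith
  have hL'0 : 0 < L' := by linarith
  -- saddle points
  set α : ℝ := saddlePoint x y with hα
  set α' : ℝ := saddlePoint (c * x) y with hα'
  have hαpos : 0 < α := saddlePoint_pos hx1 hy2
  have hα'pos : 0 < α' := saddlePoint_pos hcx1 hy2
  have hα'α : α' ≤ α := saddlePoint_antitone hx1 hcx hy2
  set Δ : ℝ := α - α' with hΔ
  have hΔ0 : 0 ≤ Δ := by rw [hΔ]; linarith
  have hsumα : saddleSum α y = L := saddleSum_saddlePoint hx1 hy2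
  have hsumα' : saddleSum α' y = L' := saddleSum_saddlePoint hcx1 hy2
  -- `Φ = φ₂(α, y)` and its lower bounds
  set Φ : ℝ := saddlePhi₂ α y with hΦdef
  have hΦ1 : c₁ * (L * ℓ) ≤ Φ := hΦ x y hy₁ hyx
  have hΦ2 : L ^ 2 * ℓ / (6 * y) ≤ Φ := sq_log_div_le_saddlePhi₂_saddlePoint hy2 hyx
  have hΦ0 : 0 < Φ := lt_of_lt_of_le (by positivity) hΦ1
  -- the tangent inequality: `Δ ≤ log c/Φ`
  have hΔΦ : Δ * Φ ≤ Real.log c := by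
    have ht := saddleSum_sub_mul_le (y := y) (σ := α') hαpos hα'pos
    rw [hsumα, hsumα', hL'eq] at ht
    have : Δ * Φ = -(saddlePhi₂ α y * (α' - α)) := by rw [hΔ, hΦdef]; ring
    linarith
  have hΔle : Δ ≤ Real.log c / Φ := by rwa [le_div_iff₀ hΦ0]
  -- (a) `Δ ℓ ≤ ℓ/(c₁ L)`
  have hΔ1 : Δ ≤ 1 / (c₁ * L) := by
    calc Δ ≤ Real.log c / Φ := hΔle
      _ ≤ ℓ / Φ := div_le_div_of_nonneg_right hlogcℓ hΦ0.le
      _ ≤ ℓ / (c₁ * (L * ℓ)) := div_le_div_of_nonneg_left hℓ0.le (by positivity) hΦ1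
      _ = 1 / (c₁ * L) := by field_simp
  have ha : Δ * ℓ ≤ 1 / c₁ * (ℓ / L) := by
    calc Δ * ℓ ≤ 1 / (c₁ * L) * ℓ := mul_le_mul_of_nonneg_right hΔ1 hℓ0.le
      _ = 1 / c₁ * (ℓ / L) := by field_simp
  -- (b) `1/α' ≤ 12 (ℓ + ℓ L'/y)` and `Δ/α' ≤ K₄ ℓ/L`
  have hα'inv : 1 / α' ≤ 12 * (ℓ + ℓ * L' / y) := by
    have h := hαmin (c * x) y hy₂ hycx
    rw [← hα', ← hℓ, ← hL'] at h
    have hpos1 : 0 < 1 / ℓ := by positivity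
    have hpos2 : 0 < (y : ℝ) / (ℓ * L') := by positivity
    rcases min_cases (1 / ℓ) ((y : ℝ) / (ℓ * L')) with ⟨hmin, _⟩ | ⟨hmin, _⟩
    · rw [hmin] at h
      -- `α' ≥ 1/(12 ℓ)` so `1/α' ≤ 12 ℓ`
      have h1 : 1 / α' ≤ 12 * ℓ := by
        rw [one_div_le hα'pos (by positivity)]
        calc 1 / (12 * ℓ) = 1 / 12 * (1 / ℓ) := by ring
          _ ≤ α' := h
      have : 0 ≤ ℓ * L' / y := by positivity
      linarith
    · rw [hmin] at h
      have h1 : 1 / α' ≤ 12 * (ℓ * L' / y) := by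
        rw [one_div_le hα'pos (by positivity)]
        calc 1 / (12 * (ℓ * L' / y)) = 1 / 12 * ((y : ℝ) / (ℓ * L')) := by field_simp
          _ ≤ α' := h
      linarith
  have hb : Δ / α' ≤ K₄ * (ℓ / L) := by
    have h1 : Δ / α' = Δ * (1 / α') := by ring
    rw [h1]
    calc Δ * (1 / α') ≤ Δ * (12 * (ℓ + ℓ * L' / y)) := mul_le_mul_of_nonneg_left hα'inv hΔ0
      _ = 12 * (Δ * ℓ) + 12 * (Δ * ℓ * L' / y) := by ring
      _ ≤ 12 * (1 / c₁ * (ℓ / L)) + 12 * (12 * (ℓ / L)) := by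
          gcongr
          -- `Δ ℓ L'/y ≤ 2 Δ ℓ L/y ≤ 2 (log c/Φ) ℓ L/y ≤ 2 ℓ² L/(y Φ) ≤ 12 ℓ/L` using `Φ ≥ L² ℓ/(6y)`
          have h2 : Δ * ℓ * L' / y ≤ 2 * (Δ * ℓ * L) / y := by
            apply div_le_div_of_nonneg_right _ hy0.le
            have := mul_le_mul_of_nonneg_left hL'2L (by positivity : 0 ≤ Δ * ℓ)
            linarith
          have h3 : 2 * (Δ * ℓ * L) / y ≤ 12 * (ℓ / L) := by
            rw [div_le_iff₀ hy0]
            -- `2 Δ ℓ L ≤ 12 ℓ y / L`  ⟸  `Δ L² ℓ ≤ 6 y ℓ` ⟸ `Δ Φ ≤ ℓ` and `Φ ≥ L² ℓ/(6y)`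
            have h4 : Δ * (L ^ 2 * ℓ / (6 * y)) ≤ Δ * Φ := mul_le_mul_of_nonneg_left hΦ2 hΔ0
            have h5 : Δ * Φ ≤ ℓ := hΔΦ.trans hlogcℓ
            have h6 : Δ * (L ^ 2 * ℓ) ≤ 6 * y * ℓ := by
              have := h4.trans h5
              rw [mul_div_assoc', div_le_iff₀ (by positivity)] at this
              linarith
            rw [show 12 * (ℓ / L) * y = 12 * ℓ * y / L by ring, le_div_iff₀ hL0]
            have h7 : 2 * (Δ * ℓ * L) * L = 2 * (Δ * (L ^ 2 * ℓ)) := by ring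
            rw [h7]; linarith
          linarith
      _ = K₄ * (ℓ / L) := by rw [hK₄]; ring
  -- `Δ (ℓ + 2/α') ≤ K₅` (using `ℓ/L ≤ 1`)
  have hℓL1 : ℓ / L ≤ 1 := by rw [div_le_one hL0]; exact hℓL
  have hexp_arg : Δ * (ℓ + 2 / α') ≤ K₅ := by
    have h1 : Δ * (ℓ + 2 / α') = Δ * ℓ + 2 * (Δ / α') := by ring
    rw [h1, hK₅]
    have h2 : 1 / c₁ * (ℓ / L) ≤ 1 / c₁ := by
      calc 1 / c₁ * (ℓ / L) ≤ 1 / c₁ * 1 := mul_le_mul_of_nonneg_left hℓL1 (by positivity)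
        _ = 1 / c₁ := mul_one _
    have h3 : K₄ * (ℓ / L) ≤ K₄ := by
      calc K₄ * (ℓ / L) ≤ K₄ * 1 := mul_le_mul_of_nonneg_left hℓL1 hK₄0.le
        _ = K₄ := mul_one _
    linarith
  -- (c) `0 ≤ G ≤ e^{K₅} ℓ/(2 c₁ L)`
  set G : ℝ := (α * L' + Real.log (smoothZeta α y)) - (α' * L' + Real.log (smoothZeta α' y)) with hG
  have hG0 : 0 ≤ G := by
    have h1 := rpow_mul_smoothZeta_saddlePoint_le hcx1 hy2 hαpos
    rw [← hα'] at h1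
    have hcx0 : 0 < c * x := by linarith
    have h2 := Real.log_le_log (by
      have := smoothZeta_pos (y := y) hα'pos
      have := Real.rpow_pos_of_pos hcx0 α'
      positivity) h1
    rw [Real.log_mul (Real.rpow_pos_of_pos hcx0 _).ne' (smoothZeta_pos hα'pos).ne',
      Real.log_mul (Real.rpow_pos_of_pos hcx0 _).ne' (smoothZeta_pos hαpos).ne',
      Real.log_rpow hcx0, Real.log_rpow hcx0] at h2
    rw [hG]; linarith
  have hG1 : G ≤ Real.exp K₅ / (2 * c₁) * (ℓ / L) := by
    have h1 : G ≤ saddlePhi₂ α' y * (α - α') ^ 2 / 2 := by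
      have := log_smoothZeta_sub_le (y := y) hα'pos hα'α hsumα'
      rw [hG]; linarith
    have h2 : saddlePhi₂ α' y ≤ Real.exp K₅ * Φ := by
      calc saddlePhi₂ α' y ≤ Real.exp ((α - α') * (Real.log y + 2 / α')) * saddlePhi₂ α y :=
            saddlePhi₂_le_exp_mul_saddlePhi₂ hα'pos hα'α
        _ ≤ Real.exp K₅ * Φ := by
            refine mul_le_mul_of_nonneg_right ?_ hΦ0.le
            rw [Real.exp_le_exp, ← hΔ, ← hℓ]; exact hexp_arg
    -- `Φ Δ² ≤ (log c)²/Φ ≤ ℓ/(c₁ L)`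
    have h3 : Φ * Δ ^ 2 ≤ 1 / c₁ * (ℓ / L) := by
      have h4 : Φ * Δ ^ 2 ≤ Δ * Real.log c := by
        calc Φ * Δ ^ 2 = Δ * (Δ * Φ) := by ring
          _ ≤ Δ * Real.log c := mul_le_mul_of_nonneg_left hΔΦ hΔ0
      have h5 : Δ * Real.log c ≤ Δ * ℓ := mul_le_mul_of_nonneg_left hlogcℓ hΔ0
      linarith
    calc G ≤ saddlePhi₂ α' y * (α - α') ^ 2 / 2 := h1
      _ = saddlePhi₂ α' y * Δ ^ 2 / 2 := by rw [hΔ]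
      _ ≤ Real.exp K₅ * Φ * Δ ^ 2 / 2 := by gcongr
      _ = Real.exp K₅ / 2 * (Φ * Δ ^ 2) := by ring
      _ ≤ Real.exp K₅ / 2 * (1 / c₁ * (ℓ / L)) := mul_le_mul_of_nonneg_left h3 (by positivity)
      _ = Real.exp K₅ / (2 * c₁) * (ℓ / L) := by field_simp
  -- (d) `0 ≤ log(α/α') ≤ Δ/α'`
  have hd0 : 0 ≤ Real.log α - Real.log α' := by linarith [Real.log_le_log hα'pos hα'α]
  have hd1 : Real.log α - Real.log α' ≤ K₄ * (ℓ / L) := by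
    have h1 : Real.log α - Real.log α' = Real.log (α / α') := (Real.log_div hαpos.ne' hα'pos.ne').symm
    have h2 : Real.log (α / α') ≤ α / α' - 1 := Real.log_le_sub_one_of_pos (by positivity)
    have h3 : α / α' - 1 = Δ / α' := by rw [hΔ]; field_simp
    linarith
  -- (e) `0 ≤ ½ log(φ₂(α')/Φ) ≤ ½ K₅'`... precisely `≤ ½ Δ(ℓ + 2/α')`
  have hφα'pos : 0 < saddlePhi₂ α' y := saddlePhi₂_pos hy2 hα'pos
  have he0 : 0 ≤ Real.log (2 * Real.pi * saddlePhi₂ α' y) - Real.log (2 * Real.pi * Φ) := by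
    have : Φ ≤ saddlePhi₂ α' y := saddlePhi₂_antitoneOn hα'pos hαpos hα'α
    linarith [Real.log_le_log (by positivity : 0 < 2 * Real.pi * Φ) (by nlinarith [Real.pi_pos] :
      2 * Real.pi * Φ ≤ 2 * Real.pi * saddlePhi₂ α' y)]
  have he1 : Real.log (2 * Real.pi * saddlePhi₂ α' y) - Real.log (2 * Real.pi * Φ) ≤
      1 / c₁ * (ℓ / L) + 2 * (K₄ * (ℓ / L)) := by
    have h1 : Real.log (2 * Real.pi * saddlePhi₂ α' y) - Real.log (2 * Real.pi * Φ) =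
        Real.log (saddlePhi₂ α' y / Φ) := by
      rw [Real.log_div hφα'pos.ne' hΦ0.ne', Real.log_mul (by positivity) hφα'pos.ne',
        Real.log_mul (by positivity) hΦ0.ne']
      ring
    have h2 : saddlePhi₂ α' y / Φ ≤ Real.exp (Δ * (ℓ + 2 / α')) := by
      rw [div_le_iff₀ hΦ0, hΔ, hℓ]
      exact saddlePhi₂_le_exp_mul_saddlePhi₂ hα'pos hα'α
    have h3 : Real.log (saddlePhi₂ α' y / Φ) ≤ Δ * (ℓ + 2 / α') := by
      have := Real.log_le_log (by positivity) h2
      rwa [Real.log_exp] at this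
    have h4 : Δ * (ℓ + 2 / α') = Δ * ℓ + 2 * (Δ / α') := by ring
    linarith
  -- assemble: the quantity is `-G + (log α - log α') - ½ (log(2πφ₂ α') - log(2πΦ))`
  have hident : (α' * L' + Real.log (smoothZeta α' y) - Real.log α' -
        1 / 2 * Real.log (2 * Real.pi * saddlePhi₂ α' y)) -
      (α * L + Real.log (smoothZeta α y) - Real.log α - 1 / 2 * Real.log (2 * Real.pi * Φ)) -
      α * Real.log c =
      -G + (Real.log α - Real.log α') -
        1 / 2 * (Real.log (2 * Real.pi * saddlePhi₂ α' y) - Real.log (2 * Real.pi * Φ)) := by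
    rw [hG, hL'eq]; ring
  have ht0 : 0 ≤ ℓ / L := by positivity
  rw [hident, abs_le]
  constructor
  · -- lower bound: `≥ -G - ½(...) ≥ -K ℓ/L`
    have : G + 1 / 2 * (Real.log (2 * Real.pi * saddlePhi₂ α' y) - Real.log (2 * Real.pi * Φ)) ≤
        K * (ℓ / L) := by
      calc G + 1 / 2 * (Real.log (2 * Real.pi * saddlePhi₂ α' y) - Real.log (2 * Real.pi * Φ))
          ≤ Real.exp K₅ / (2 * c₁) * (ℓ / L) + 1 / 2 * (1 / c₁ * (ℓ / L) + 2 * (K₄ * (ℓ / L))) :=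
            add_le_add hG1 (mul_le_mul_of_nonneg_left he1 (by norm_num))
        _ = (Real.exp K₅ / (2 * c₁) + 1 / (2 * c₁) + K₄) * (ℓ / L) := by ring
        _ ≤ K * (ℓ / L) := by
            refine mul_le_mul_of_nonneg_right ?_ ht0
            rw [hK]; linarith
    linarith
  · have : Real.log α - Real.log α' ≤ K * (ℓ / L) := by
      calc Real.log α - Real.log α' ≤ K₄ * (ℓ / L) := hd1
        _ ≤ K * (ℓ / L) := by
            refine mul_le_mul_of_nonneg_right ?_ ht0
            rw [hK]
            have : 0 ≤ Real.exp K₅ / (2 * c₁) := by positivity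
            have : 0 ≤ 1 / (2 * c₁) := by positivity
            linarith
    linarith [hG0, he0]

/-! ### The main regime `y ≥ y₀`, `u ≥ u₀`, from Theorem 1 -/

set_option maxHeartbeats 400000 in
-- a long estimate with a large context
/-- **The main regime.** Assume Hildebrand–Tenenbaum's Theorem 1 with constant `C ≥ 1` (the hypothesis
`hHT`, verbatim (2.3) for real `x`, natural `y`, `2 ≤ y ≤ x`). Then there are `K`, `u₀ ≥ 1`, `y₀` with
`|Ψ(cx, y) - c^α Ψ(x, y)| ≤ K (log y/log x + log y/y) c^α Ψ(x, y)` for `y ≥ y₀`, `x ≥ y`,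
`log x ≥ u₀ log y`, `1 ≤ c ≤ y` (`α = α(x, y)`): Theorem 1 at `x` and `cx` with errors `≤ 1/2`, the core
estimate `exists_abs_log_mainTerm_sub_le`, and `|e^R - 1| ≤ 2|R|`.
[cite: HildebrandTenenbaum1986, §6 (proof of Thm 3)] -/
theorem exists_mainRegime {C : ℝ} (hC1 : 1 ≤ C)
    (hHT : ∀ (x : ℝ) (y : ℕ), 2 ≤ y → (y : ℝ) ≤ x →
      |((Nat.smoothNumbersUpTo ⌊x⌋₊ (y + 1)).card : ℝ) -
          x ^ saddlePoint x y * smoothZeta (saddlePoint x y) y /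
            (saddlePoint x y * Real.sqrt (2 * Real.pi * saddlePhi₂ (saddlePoint x y) y))| ≤
        C * (Real.log y / Real.log x + Real.log y / y) *
          (x ^ saddlePoint x y * smoothZeta (saddlePoint x y) y /
            (saddlePoint x y * Real.sqrt (2 * Real.pi * saddlePhi₂ (saddlePoint x y) y)))) :
    ∃ K u₀ : ℝ, ∃ y₀ : ℕ, 0 < K ∧ 1 ≤ u₀ ∧ 2 ≤ y₀ ∧ ∀ (x : ℝ) (y : ℕ) (c : ℝ), y₀ ≤ y → (y : ℝ) ≤ x →
      u₀ * Real.log y ≤ Real.log x → 1 ≤ c → c ≤ y →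
      |((Nat.smoothNumbersUpTo ⌊c * x⌋₊ (y + 1)).card : ℝ) -
          c ^ saddlePoint x y * ((Nat.smoothNumbersUpTo ⌊x⌋₊ (y + 1)).card : ℝ)| ≤
        K * (Real.log y / Real.log x + Real.log y / y) *
          (c ^ saddlePoint x y * ((Nat.smoothNumbersUpTo ⌊x⌋₊ (y + 1)).card : ℝ)) := by
  obtain ⟨K, yK, hK0, hyK2, hcore⟩ := exists_abs_log_mainTerm_sub_le
  have hC0 : 0 < C := by linarith
  set K₇ : ℝ := K + 4 * C with hK₇
  have hK₇0 : 0 < K₇ := by positivity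
  set u₀ : ℝ := max (4 * C) (2 * K₇) with hu₀
  have hu₀C : 4 * C ≤ u₀ := le_max_left _ _
  have hu₀K : 2 * K₇ ≤ u₀ := le_max_right _ _
  have hu₀1 : 1 ≤ u₀ := by linarith
  have hu₀0 : 0 < u₀ := by linarith
  obtain ⟨Y, hY1, hY⟩ := exists_log_le_mul_rpow (κ := 1 / (4 * K₇)) (ε := 1) (by positivity) one_pos
  refine ⟨2 * K₇, u₀, max yK ⌈Y⌉₊, by positivity, hu₀1, le_trans hyK2 (le_max_left _ _),
    fun x y c hy hyx hux hc1 hcy => ?_⟩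
  have hyK : yK ≤ y := le_trans (le_max_left _ _) hy
  have hyY : Y ≤ y := le_trans (Nat.le_ceil Y) (by exact_mod_cast le_trans (le_max_right _ _) hy)
  have hy2 : 2 ≤ y := hyK2.trans hyK
  have hy2r : (2 : ℝ) ≤ y := by exact_mod_cast hy2
  have hy1 : (1 : ℝ) < y := by linarith
  have hy0 : (0 : ℝ) < y := by linarith
  have hx1 : 1 < x := by linarith
  have hx0 : 0 < x := by linarith
  have hc0 : 0 < c := by linarith
  have hcx : x ≤ c * x := le_mul_of_one_le_left hx0.le hc1
  have hcx1 : 1 < c * x := lt_of_lt_of_le hx1 hcx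
  have hcx0 : 0 < c * x := by linarith
  have hycx : (y : ℝ) ≤ c * x := hyx.trans hcx
  set ℓ : ℝ := Real.log y with hℓ
  set L : ℝ := Real.log x with hL
  set L' : ℝ := Real.log (c * x) with hL'
  have hℓ0 : 0 < ℓ := Real.log_pos hy1
  have hL0 : 0 < L := Real.log_pos hx1
  have hL'L : L ≤ L' := Real.log_le_log hx0 hcx
  have hL'0 : 0 < L' := by linarith
  -- the errors `E = C(ℓ/L + ℓ/y) ≤ 1/2`, `E' = C(ℓ/L' + ℓ/y) ≤ E`
  have hℓL : ℓ / L ≤ 1 / u₀ := by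
    rw [div_le_div_iff₀ hL0 hu₀0]; linarith
  have hℓy : K₇ * (ℓ / y) ≤ 1 / 4 := by
    have h1 : ℓ ≤ 1 / (4 * K₇) * (y : ℝ) ^ (1 : ℝ) := hY y hyY
    rw [Real.rpow_one] at h1
    rw [mul_div_assoc', div_le_iff₀ hy0]
    calc K₇ * ℓ ≤ K₇ * (1 / (4 * K₇) * y) := mul_le_mul_of_nonneg_left h1 hK₇0.le
      _ = 1 / 4 * y := by field_simp
  set E : ℝ := C * (ℓ / L + ℓ / y) with hE
  set E' : ℝ := C * (ℓ / L' + ℓ / y) with hE'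
  have hE0 : 0 ≤ E := by positivity
  have hE'0 : 0 ≤ E' := by positivity
  have hE'E : E' ≤ E := by
    rw [hE, hE']
    refine mul_le_mul_of_nonneg_left ?_ hC0.le
    have : ℓ / L' ≤ ℓ / L := div_le_div_of_nonneg_left hℓ0.le hL0 hL'L
    linarith
  have hEhalf : E ≤ 1 / 2 := by
    have h1 : C * (ℓ / L) ≤ 1 / 4 := by
      calc C * (ℓ / L) ≤ C * (1 / u₀) := mul_le_mul_of_nonneg_left hℓL hC0.le
        _ ≤ C * (1 / (4 * C)) := by
            refine mul_le_mul_of_nonneg_left ?_ hC0.le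
            exact one_div_le_one_div_of_le (by positivity) hu₀C
        _ = 1 / 4 := by field_simp
    have h2 : C * (ℓ / y) ≤ 1 / 4 := by
      have : C * (ℓ / y) ≤ K₇ * (ℓ / y) := by
        refine mul_le_mul_of_nonneg_right ?_ (by positivity); rw [hK₇]; linarith
      linarith
    rw [hE, mul_add]; linarith
  have hE'half : E' ≤ 1 / 2 := hE'E.trans hEhalf
  -- the main term `M(z)` and Theorem 1 at `x` and `cx`
  set M : ℝ → ℝ := fun z => z ^ saddlePoint z y * smoothZeta (saddlePoint z y) y /
      (saddlePoint z y * Real.sqrt (2 * Real.pi * saddlePhi₂ (saddlePoint z y) y)) with hM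
  have hMpos : ∀ z : ℝ, 1 < z → 0 < M z := by
    intro z hz
    have hα : 0 < saddlePoint z y := saddlePoint_pos hz hy2
    have hζ : 0 < smoothZeta (saddlePoint z y) y := smoothZeta_pos hα
    have hφ : 0 < saddlePhi₂ (saddlePoint z y) y := saddlePhi₂_pos hy2 hα
    have h1 : 0 < z ^ saddlePoint z y := Real.rpow_pos_of_pos (by linarith) _
    have h2 : 0 < Real.sqrt (2 * Real.pi * saddlePhi₂ (saddlePoint z y) y) :=
      Real.sqrt_pos.mpr (by positivity)
    show 0 < z ^ saddlePoint z y * smoothZeta (saddlePoint z y) y /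
      (saddlePoint z y * Real.sqrt (2 * Real.pi * saddlePhi₂ (saddlePoint z y) y))
    positivity
  have hHTx : |((Nat.smoothNumbersUpTo ⌊x⌋₊ (y + 1)).card : ℝ) - M x| ≤ E * M x := hHT x y hy2 hyx
  have hHTcx : |((Nat.smoothNumbersUpTo ⌊c * x⌋₊ (y + 1)).card : ℝ) - M (c * x)| ≤ E' * M (c * x) :=
    hHT (c * x) y hy2 hycx
  obtain ⟨hΨx, hlogΨx⟩ := abs_log_sub_log_le_of_abs_sub_le (hMpos x hx1) hE0 hEhalf hHTx
  obtain ⟨hΨcx, hlogΨcx⟩ := abs_log_sub_log_le_of_abs_sub_le (hMpos (c * x) hcx1) hE'0 hE'half hHTcx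
  -- the logs of the main terms and the core estimate
  set α : ℝ := saddlePoint x y with hα
  set α' : ℝ := saddlePoint (c * x) y with hα'
  have hαpos : 0 < α := saddlePoint_pos hx1 hy2
  have hα'pos : 0 < α' := saddlePoint_pos hcx1 hy2
  have hlogMx : Real.log (M x) = α * L + Real.log (smoothZeta α y) - Real.log α -
      1 / 2 * Real.log (2 * Real.pi * saddlePhi₂ α y) := log_mainTerm_eq hx1 hy2 hαpos
  have hlogMcx : Real.log (M (c * x)) = α' * L' + Real.log (smoothZeta α' y) - Real.log α' -
      1 / 2 * Real.log (2 * Real.pi * saddlePhi₂ α' y) := log_mainTerm_eq hcx1 hy2 hα'pos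
  have hD := hcore x y c hyK hyx hc1 hcy
  rw [← hα, ← hα', ← hL, ← hL', ← hℓ, ← hlogMx, ← hlogMcx] at hD
  -- `R = log Ψ(cx) - log Ψ(x) - α log c` has `|R| ≤ K₇ (ℓ/L + ℓ/y) ≤ 3/4`
  set Ψx : ℝ := ((Nat.smoothNumbersUpTo ⌊x⌋₊ (y + 1)).card : ℝ) with hΨxdef
  set Ψcx : ℝ := ((Nat.smoothNumbersUpTo ⌊c * x⌋₊ (y + 1)).card : ℝ) with hΨcxdef
  have hRle : |Real.log Ψcx - Real.log Ψx - α * Real.log c| ≤ K₇ * (ℓ / L + ℓ / y) := by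
    have h4 : K * (ℓ / L) ≤ K * (ℓ / L + ℓ / y) := by
      refine mul_le_mul_of_nonneg_left ?_ hK0.le
      have : 0 ≤ ℓ / y := by positivity
      linarith
    have hK₇E : K₇ * (ℓ / L + ℓ / y) = K * (ℓ / L + ℓ / y) + 2 * E + 2 * E := by rw [hK₇, hE]; ring
    rw [abs_le] at hlogΨx hlogΨcx hD ⊢
    obtain ⟨hD1, hD2⟩ := hD
    obtain ⟨hx1', hx2'⟩ := hlogΨx
    obtain ⟨hcx1', hcx2'⟩ := hlogΨcx
    constructor <;> linarith
  have hR1 : K₇ * (ℓ / L + ℓ / y) ≤ 1 := by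
    have h1 : K₇ * (ℓ / L) ≤ 1 / 2 := by
      calc K₇ * (ℓ / L) ≤ K₇ * (1 / u₀) := mul_le_mul_of_nonneg_left hℓL hK₇0.le
        _ ≤ K₇ * (1 / (2 * K₇)) := by
            refine mul_le_mul_of_nonneg_left ?_ hK₇0.le
            exact one_div_le_one_div_of_le (by positivity) hu₀K
        _ = 1 / 2 := by field_simp
    calc K₇ * (ℓ / L + ℓ / y) = K₇ * (ℓ / L) + K₇ * (ℓ / y) := by ring
      _ ≤ 1 := by linarith
  -- conclude: `|Ψ(cx) - c^α Ψ(x)| ≤ 2 K₇ (ℓ/L + ℓ/y) c^α Ψ(x)`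
  have hcα : 0 < c ^ α := Real.rpow_pos_of_pos hc0 α
  rw [← Real.log_rpow hc0] at hRle
  have hfin := abs_sub_mul_le_of_abs_log_le hΨx hΨcx hcα hR1 hRle
  rw [show (2 : ℝ) * K₇ * (ℓ / L + ℓ / y) = 2 * (K₇ * (ℓ / L + ℓ / y)) by ring]
  exact hfin

/-! ### The small-`u` regime -/

/-- **Small `u`**: for `u₀ ≥ 1` there are `K`, `y₀` with `Ψ(cx, y) ≤ K c^{α(x,y)} Ψ(x, y)` whenever
`y ≥ y₀`, `y ≤ x`, `log x ≤ u₀ log y`, `1 ≤ c ≤ y`: `Ψ(cx, y) ≤ cx`, `Ψ(x, y) ≥ δ(u₀) x`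
(`exists_card_smoothNumbersUpTo_ge_mul_of_le_rpow`) and `c ≤ c^α y^{1-α} ≤ (80u₀)² c^α`
(`exists_one_sub_saddlePoint_mul_log_le`). [cite: HildebrandTenenbaum1986, §6 (proof of Thm 3, (6.1))] -/
theorem exists_smallU {u₀ : ℝ} (hu₀ : 1 ≤ u₀) :
    ∃ K : ℝ, ∃ y₀ : ℕ, 0 < K ∧ 2 ≤ y₀ ∧ ∀ (x : ℝ) (y : ℕ) (c : ℝ), y₀ ≤ y → (y : ℝ) ≤ x →
      Real.log x ≤ u₀ * Real.log y → 1 ≤ c → c ≤ y →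
      ((Nat.smoothNumbersUpTo ⌊c * x⌋₊ (y + 1)).card : ℝ) ≤
        K * (c ^ saddlePoint x y * ((Nat.smoothNumbersUpTo ⌊x⌋₊ (y + 1)).card : ℝ)) := by
  obtain ⟨δ, hδ, X₀, hD⟩ := exists_card_smoothNumbersUpTo_ge_mul_of_le_rpow hu₀
  obtain ⟨y₁, hy₁2, hα1⟩ := exists_one_sub_saddlePoint_mul_log_le hu₀
  set K₃ : ℝ := (80 * u₀) ^ 2 with hK₃
  have hK₃1 : 1 ≤ K₃ := by rw [hK₃]; nlinarith
  refine ⟨K₃ / δ, max y₁ ⌈X₀⌉₊, by positivity, le_trans hy₁2 (le_max_left _ _),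
    fun x y c hy hyx hux hc1 hcy => ?_⟩
  have hy₁ : y₁ ≤ y := le_trans (le_max_left _ _) hy
  have hyX : X₀ ≤ y := le_trans (Nat.le_ceil X₀) (by exact_mod_cast le_trans (le_max_right _ _) hy)
  have hy2 : 2 ≤ y := hy₁2.trans hy₁
  have hy2r : (2 : ℝ) ≤ y := by exact_mod_cast hy2
  have hy1 : (1 : ℝ) < y := by linarith
  have hy0 : (0 : ℝ) < y := by linarith
  have hx1 : 1 < x := by linarith
  have hx0 : 0 < x := by linarith
  have hc0 : 0 < c := by linarith
  set α : ℝ := saddlePoint x y with hα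
  have hαpos : 0 < α := saddlePoint_pos hx1 hy2
  -- `Ψ(x, y) ≥ δ x`
  have hxy : x ≤ (y : ℝ) ^ u₀ := by
    rw [← Real.exp_log hx0, Real.rpow_def_of_pos hy0, Real.exp_le_exp]; linarith
  have hΨx := hD x y (hyX.trans hyx) hy2 hxy
  -- `c ≤ K₃ c^α`
  have hcα : 0 < c ^ α := Real.rpow_pos_of_pos hc0 α
  have hcle : c ≤ K₃ * c ^ α := by
    by_cases hα1' : 1 ≤ α
    · calc c = c ^ (1 : ℝ) := (Real.rpow_one c).symm
        _ ≤ c ^ α := Real.rpow_le_rpow_of_exponent_le hc1 hα1'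
        _ ≤ K₃ * c ^ α := le_mul_of_one_le_left hcα.le hK₃1
    · push Not at hα1'
      have h1 := hα1 x y hy₁ hyx hux
      rw [← hα] at h1
      have h2 : c ^ (1 - α) ≤ K₃ := by
        calc c ^ (1 - α) ≤ (y : ℝ) ^ (1 - α) := Real.rpow_le_rpow hc0.le hcy (by linarith)
          _ = Real.exp ((1 - α) * Real.log y) := by rw [Real.rpow_def_of_pos hy0, mul_comm]
          _ ≤ Real.exp (2 * Real.log (80 * u₀)) := Real.exp_le_exp.2 h1
          _ = K₃ := by
              rw [hK₃, ← Real.log_rpow (by linarith), Real.exp_log (by positivity)]; norm_num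
      calc c = c ^ α * c ^ (1 - α) := by
            rw [← Real.rpow_add hc0]; norm_num
        _ ≤ c ^ α * K₃ := mul_le_mul_of_nonneg_left h2 hcα.le
        _ = K₃ * c ^ α := mul_comm _ _
  calc ((Nat.smoothNumbersUpTo ⌊c * x⌋₊ (y + 1)).card : ℝ) ≤ c * x :=
        card_smoothNumbersUpTo_le_self (by positivity) y
    _ ≤ K₃ * c ^ α * x := mul_le_mul_of_nonneg_right hcle hx0.le
    _ = K₃ / δ * (c ^ α * (δ * x)) := by field_simp
    _ ≤ K₃ / δ * (c ^ α * ((Nat.smoothNumbersUpTo ⌊x⌋₊ (y + 1)).card : ℝ)) := by gcongr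

/-! ### Assembly -/

/-- **Hildebrand–Tenenbaum's Theorem 3 from their Theorem 1** [HildebrandTenenbaum1986, §6]. The
hypothesis is Theorem 1 (2.3) verbatim — "uniformly for `x ≥ y ≥ 2`,
`Ψ(x, y) = x^α ζ(α, y)/(α √(2π φ₂(α, y))) (1 + O(1/u + (log y)/y))`" — for real `x` and natural `y`,
`2 ≤ y ≤ x`, with `Ψ(x, y) = #(Nat.smoothNumbersUpTo ⌊x⌋₊ (y + 1))` and the tree's `saddlePoint`,
`smoothZeta`, `saddlePhi₂`; it is not proved in the tree (it needs the prime number theorem with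
Vinogradov's zero-free region, op. cit. Lemma 6, and de Bruijn's `Ψ ∼ xρ` for small `u`), and a proving
seat may not mint it as a named fact (D-0026), so it is spelled out. The conclusion is the named fact
`HTLocalBehaviour` (Theorem 3 (2.9)). Proof: bounded `y` (`card_smoothNumbersUpTo_mul_le_pow`), bounded `u`
(`exists_smallU`), and the main regime (`exists_mainRegime`). [cite: HildebrandTenenbaum1986, Thm 3 and §6] -/
theorem HTLocalBehaviour_of_saddleAsymptotic
    (hHT : ∃ C : ℝ, ∀ (x : ℝ) (y : ℕ), 2 ≤ y → (y : ℝ) ≤ x →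
      |((Nat.smoothNumbersUpTo ⌊x⌋₊ (y + 1)).card : ℝ) -
          x ^ saddlePoint x y * smoothZeta (saddlePoint x y) y /
            (saddlePoint x y * Real.sqrt (2 * Real.pi * saddlePhi₂ (saddlePoint x y) y))| ≤
        C * (Real.log y / Real.log x + Real.log y / y) *
          (x ^ saddlePoint x y * smoothZeta (saddlePoint x y) y /
            (saddlePoint x y * Real.sqrt (2 * Real.pi * saddlePhi₂ (saddlePoint x y) y)))) :
    HTLocalBehaviour := by
  obtain ⟨C, hC⟩ := hHT
  -- WLOG `C ≥ 1`
  have hC' : ∀ (x : ℝ) (y : ℕ), 2 ≤ y → (y : ℝ) ≤ x →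
      |((Nat.smoothNumbersUpTo ⌊x⌋₊ (y + 1)).card : ℝ) -
          x ^ saddlePoint x y * smoothZeta (saddlePoint x y) y /
            (saddlePoint x y * Real.sqrt (2 * Real.pi * saddlePhi₂ (saddlePoint x y) y))| ≤
        max C 1 * (Real.log y / Real.log x + Real.log y / y) *
          (x ^ saddlePoint x y * smoothZeta (saddlePoint x y) y /
            (saddlePoint x y * Real.sqrt (2 * Real.pi * saddlePhi₂ (saddlePoint x y) y))) := by
    intro x y hy hyx
    refine (hC x y hy hyx).trans ?_
    have hy1 : (1 : ℝ) < y := by exact_mod_cast lt_of_lt_of_le one_lt_two hy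
    have hx1 : 1 < x := by linarith
    have hα : 0 < saddlePoint x y := saddlePoint_pos hx1 hy
    have hζ : 0 < smoothZeta (saddlePoint x y) y := smoothZeta_pos hα
    have h1 : 0 < x ^ saddlePoint x y := Real.rpow_pos_of_pos (by linarith) _
    have h2 : 0 < Real.sqrt (2 * Real.pi * saddlePhi₂ (saddlePoint x y) y) :=
      Real.sqrt_pos.mpr (by have := saddlePhi₂_pos hy hα; positivity)
    have hlog : 0 ≤ Real.log y / Real.log x + Real.log y / y := by
      have := Real.log_pos hy1; have := Real.log_pos hx1; positivity
    refine mul_le_mul_of_nonneg_right (mul_le_mul_of_nonneg_right (le_max_left _ _) hlog) ?_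
    positivity
  obtain ⟨Km, u₀, ym, hKm, hu₀, hym2, hmain⟩ := exists_mainRegime (le_max_right C 1) hC'
  obtain ⟨Ks, ys, hKs, hys2, hsmall⟩ := exists_smallU hu₀
  set y₀ : ℕ := max ym ys with hy₀
  have hy₀2 : 2 ≤ y₀ := le_trans hym2 (le_max_left _ _)
  set K₁ : ℝ := ((1 + (y₀ : ℝ)) ^ y₀ + 1) * ((y₀ : ℝ) / Real.log 2) with hK₁
  have hl2 : 0 < Real.log 2 := Real.log_pos one_lt_two
  refine ⟨max (max Km ((Ks + 1) * u₀)) K₁, fun x y hy2 hyx c hc1 hcy => ?_⟩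
  have hy2r : (2 : ℝ) ≤ y := by exact_mod_cast hy2
  have hy1 : (1 : ℝ) < y := by linarith
  have hy0 : (0 : ℝ) < y := by linarith
  have hx1 : 1 < x := by linarith
  have hx0 : 0 < x := by linarith
  have hc0 : 0 < c := by linarith
  have hℓ0 : 0 < Real.log y := Real.log_pos hy1
  have hL0 : 0 < Real.log x := Real.log_pos hx1
  set α : ℝ := saddlePoint x y with hα
  have hαpos : 0 < α := saddlePoint_pos hx1 hy2
  have hcα1 : 1 ≤ c ^ α := Real.one_le_rpow hc1 hαpos.le
  set Ψx : ℝ := ((Nat.smoothNumbersUpTo ⌊x⌋₊ (y + 1)).card : ℝ) with hΨxdef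
  set Ψcx : ℝ := ((Nat.smoothNumbersUpTo ⌊c * x⌋₊ (y + 1)).card : ℝ) with hΨcxdef
  have hΨx1 : 1 ≤ Ψx := one_le_card_smoothNumbersUpTo hx1.le y
  have hΨcx0 : 0 ≤ Ψcx := Nat.cast_nonneg _
  have hfac0 : 0 ≤ Real.log y / Real.log x + Real.log y / y := by positivity
  have hP0 : 0 ≤ c ^ α * Ψx := by positivity
  -- a bound of the shape `Ψ(cx) ≤ B c^α Ψ(x)` gives `|…| ≤ (B + 1) c^α Ψ(x)`
  have hcrude : ∀ B : ℝ, Ψcx ≤ B * (c ^ α * Ψx) → |Ψcx - c ^ α * Ψx| ≤ (B + 1) * (c ^ α * Ψx) := by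
    intro B hB
    calc |Ψcx - c ^ α * Ψx| ≤ |Ψcx| + |c ^ α * Ψx| := abs_sub _ _
      _ = Ψcx + c ^ α * Ψx := by rw [abs_of_nonneg hΨcx0, abs_of_nonneg hP0]
      _ ≤ B * (c ^ α * Ψx) + c ^ α * Ψx := by linarith
      _ = (B + 1) * (c ^ α * Ψx) := by ring
  by_cases hy : y₀ ≤ y
  · have hym : ym ≤ y := le_trans (le_max_left _ _) hy
    have hys : ys ≤ y := le_trans (le_max_right _ _) hy
    by_cases hu : u₀ * Real.log y ≤ Real.log x
    · -- main regime
      have h := hmain x y c hym hyx hu hc1 hcy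
      refine h.trans ?_
      refine mul_le_mul_of_nonneg_right (mul_le_mul_of_nonneg_right ?_ hfac0) hP0
      exact (le_max_left _ _).trans (le_max_left _ _)
    · -- small `u`: the error factor is `≥ log y/log x > 1/u₀`
      push Not at hu
      have h := hsmall x y c hys hyx hu.le hc1 hcy
      have h1 := hcrude Ks h
      have h2 : 1 ≤ u₀ * (Real.log y / Real.log x + Real.log y / y) := by
        have : 1 ≤ u₀ * (Real.log y / Real.log x) := by
          rw [mul_div_assoc', le_div_iff₀ hL0]; linarith
        have : 0 ≤ u₀ * (Real.log y / y) := by positivity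
        nlinarith
      calc |Ψcx - c ^ α * Ψx| ≤ (Ks + 1) * (c ^ α * Ψx) := h1
        _ ≤ (Ks + 1) * (u₀ * (Real.log y / Real.log x + Real.log y / y)) * (c ^ α * Ψx) := by
            refine mul_le_mul_of_nonneg_right ?_ hP0
            exact le_mul_of_one_le_right (by positivity) h2
        _ = (Ks + 1) * u₀ * (Real.log y / Real.log x + Real.log y / y) * (c ^ α * Ψx) := by ring
        _ ≤ max (max Km ((Ks + 1) * u₀)) K₁ * (Real.log y / Real.log x + Real.log y / y) *
              (c ^ α * Ψx) := by
            refine mul_le_mul_of_nonneg_right (mul_le_mul_of_nonneg_right ?_ hfac0) hP0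
            exact (le_max_right _ _).trans (le_max_left _ _)
  · -- bounded `y`: `Ψ(cx) ≤ (1 + y)^{y₀} Ψ(x)` as `c ≤ y < y₀ ≤ 2^{y₀}`, and `log y/y ≥ log 2/y₀`
    push Not at hy
    have hyy₀ : (y : ℝ) ≤ y₀ := by exact_mod_cast hy.le
    have hc2 : c ≤ 2 ^ y₀ := by
      calc c ≤ y := hcy
        _ ≤ y₀ := hyy₀
        _ ≤ 2 ^ y₀ := by exact_mod_cast (Nat.lt_two_pow_self).le
    have h1 := card_smoothNumbersUpTo_mul_le_pow y₀ hx1.le hc2 y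
    have h2 : ((1 : ℝ) + y) ^ y₀ ≤ (1 + (y₀ : ℝ)) ^ y₀ := pow_le_pow_left₀ (by positivity) (by linarith) _
    have h3 : Ψcx ≤ (1 + (y₀ : ℝ)) ^ y₀ * (c ^ α * Ψx) := by
      calc Ψcx ≤ (1 + (y : ℝ)) ^ y₀ * Ψx := h1
        _ ≤ (1 + (y₀ : ℝ)) ^ y₀ * Ψx := mul_le_mul_of_nonneg_right h2 (by linarith)
        _ ≤ (1 + (y₀ : ℝ)) ^ y₀ * (c ^ α * Ψx) := by
            refine mul_le_mul_of_nonneg_left ?_ (by positivity)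
            exact le_mul_of_one_le_left (by linarith) hcα1
    have h4 := hcrude _ h3
    -- `1 ≤ (y₀/log 2)(log y/log x + log y/y)`
    have h5 : 1 ≤ (y₀ : ℝ) / Real.log 2 * (Real.log y / Real.log x + Real.log y / y) := by
      have hl2y : Real.log 2 ≤ Real.log y := Real.log_le_log two_pos hy2r
      have h6 : 1 ≤ (y₀ : ℝ) / Real.log 2 * (Real.log y / y) := by
        rw [div_mul_div_comm, le_div_iff₀ (by positivity)]
        nlinarith
      have : 0 ≤ (y₀ : ℝ) / Real.log 2 * (Real.log y / Real.log x) := by positivity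
      nlinarith
    calc |Ψcx - c ^ α * Ψx| ≤ ((1 + (y₀ : ℝ)) ^ y₀ + 1) * (c ^ α * Ψx) := h4
      _ ≤ ((1 + (y₀ : ℝ)) ^ y₀ + 1) * ((y₀ : ℝ) / Real.log 2 *
            (Real.log y / Real.log x + Real.log y / y)) * (c ^ α * Ψx) := by
          refine mul_le_mul_of_nonneg_right ?_ hP0
          exact le_mul_of_one_le_right (by positivity) h5
      _ = K₁ * (Real.log y / Real.log x + Real.log y / y) * (c ^ α * Ψx) := by rw [hK₁]; ring
      _ ≤ max (max Km ((Ks + 1) * u₀)) K₁ * (Real.log y / Real.log x + Real.log y / y) *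
            (c ^ α * Ψx) :=
          mul_le_mul_of_nonneg_right (mul_le_mul_of_nonneg_right (le_max_right _ _) hfac0) hP0

end Literature.NumberTheory.Sieve
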